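import Summits.BirchSwinnertonDyer.BirchSwinnertonDyer.Theses.ErratumRoadFive
import Literature.NumberTheory.EllipticCurves.Kato2004.AdmissibleZetaClassRealisability
import Literature.NumberTheory.EllipticCurves.MordellWeilTheoremProofs
import Literature.NumberTheory.EllipticCurves.TateModuleContinuityProofs
import Literature.NumberTheory.EllipticCurves.LeadingTerm
import Literature.NumberTheory.EllipticCurves.Rank1Residual.Typed.Basic
import HarnessLib

/-!
# Line `kato_Fframe` — STAGE 1 skeleton of the door «kato-bottom-layer-exczero» on
# `ErratumRoadFive.EulerHalfNotRamNoInertSetAtFive` (stmt-BirchSwinnertonDyer-19715) — rev 2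

DRAFT TURNKEY (planner-bsd-idea-9, lens = complete; rev 1 g35 3f0a913fb0763e68, critic V253 PASS, pen own
farm check GREEN 2026-08-30T00:34:32Z; rev 2 g36 = the same line with the critic's words W1–W6 and the pen's
hygiene item answered: NO `def … : Prop` is left in the file (the door regime is stated INLINE in the stub
signatures), the Tamagawa-defect part J2 of the old residual is re-typed as ONE named print-open statement
(S1♯ = Büyükboduk's Question 2 in logarithm currency), the residual shrinks to J1 ∪ J3, cites re-keyed to
`references.bib`). Published by `ledger crux write` ONLY; NOT registered (W-79: the line of record on 19715
stays `Lines/birth.lean` v17, which closes the crux modulo published inputs + the `p ≥ 5` part of crux 19064);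
the route pen / LEAD keys or discards it at GATE B. Nothing here is a route item; no summit statement, crux
or stub is proved by this file; BSD is proved for no curve.

## The line in one paragraph

For `(E, p)` in the target class (X11b, `p ≥ 5`, `ρ̄_{E,p}` onto, no (ram) prime, `p ∣ ∏ c_ℓ`, no
inert-set datum) the Euler half `ord_p #Ш ≤ ord_p #Ш_an` is read off the BOTTOM LAYER of Kato's
`Ω_E`-normalised Λ-adic zeta element — the tree's ADMISSIBLE class `z₀` (`Kato2004.IsAdmissibleZetaClass`,
realisable at `p ≥ 5`, `ρ̄` onto, by the tree's named fact `exists_isAdmissibleZetaClass_of_imageContainsSL2`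
= Kato Thm. 12.5 (4)) — through its KUMMER LOGARITHM `t = log_ω(loc_p z_ℚ)` (`Kato2004.HasLocPKummerLog`,
tree currency, no `B_dR`), NOT through a `p`-adic height (the Schneider / `𝓛`-invariant barrier is not
met: `log_ω` of the Mordell–Weil generator is non-zero unconditionally). What this line buys relative to
the line of record: on the DOOR REGIME (`p` split multiplicative ∧ `ord_p ∏c_ℓ = ord_p c_p` ∧ `E(ℚ_p)[p] = 0`
— the S1b branch of `birth.lean` v17, 334 of the 404 census pairs, minus its J3 part) the Euler half no
longer leans on crux 19064 (`X11aLowerHalf`) but on three statements about ONE curve: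

* `stub_katoKolyvaginLogBound` S1 (PRINT, size L; ANY reduction type at `p`): Mazur–Rubin Thm. 5.2.2 /
  Kim, *Structure of Selmer groups* (AJM; arXiv:2203.12159) Thm. 2.12 + Cor. 2.15 for Kato's Kolyvagin system
  of `(T_pE, F_can)` + `length Sel₀ = ord_p #Ш + e` at rank one + Bloch–Kato Ex. 3.11, read through `log_ω`:
  `ord_p #Ш + ord_p log_ω(x̂) − ord_p log_ω(Q) ≤ ord_p t − ord_p log_ω(x̂)` for every local point `Q` with
  `log_ω(Q) ≠ 0`.
* `stub_katoKolyvaginLogBoundTamagawa` S1♯ (PRINT-OPEN, size XL; NEW in rev 2): the same bound at a SPLIT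
  multiplicative `p` when a SECOND prime carries `p` in the Tamagawa product (`ord_p ∏c_ℓ ≠ ord_p c_p`), with
  the full away-from-`p` defect `ord_p ∏c_ℓ − ord_p c_p = Σ_{ℓ≠p} ord_p c_ℓ` added on the left — i.e. Kato's
  Kolyvagin system is divisible by `p^{Σ_{ℓ≠p} ord_p c_ℓ}` in `KS(T_pE, F_can)`. One factor `p^{ord_p c_ℓ}` is
  Büyükboduk 2009 Thm. B; the full product is his QUESTION 2 (open; = the Tamagawa part of Kim's Conj. 1.10;
  for `p ∤ N` it is the theorem (eq:M-kato) of Castella–Sano 2026 GIVEN Kato's main conjecture). It serves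
  the J2 pairs (the 36 of the 70 three-multiplicative-prime census pairs at which `p` is SPLIT; smallest
  8085y1@5, 12705q1@7) conditionally on ONE named statement.
* `stub_tateUniformisationLogValue` S2 (PROVABLE, size M–L, Tate curve): at a split multiplicative `p ≥ 5`
  with `E(ℚ_p)[p] = 0` some local point has `ord_p log_ω(Q) = 1 − ord_p(c_p)` exactly.
* `stub_integralExcZeroValue` S3 = THE TRANSFER STATEMENT C⁺ (research, size XL; the door): the integral
  exceptional-zero Perrin-Riou formula in VALUATION form, upper half only —
  `ord_p t − 2·ord_p log_ω(x̂) ≤ ord_p #Ш_an + ord_p ∏c_ℓ − 2·ord_p #E(ℚ)_tors + ord_p(1 − p⁻¹)`.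
  Print gives the identity up to `ℚˣ` (Venerucci 2016 Thm. A [arXiv:1407.1913 p. 3]: conductor `Np`, `p > 3`
  split multiplicative, `A_p` irreducible, `L(A,1) = 0` — NO hypothesis on `ord_p(q_A)`, so `p ∣ c_p` on all
  334 door pairs does not void it; Disegni 2020 Prop. 5); the proposed proof of integrality is the F-frame
  chain S3–S6 of `Lines/kato_bottom_layer_Fframe.md` rev 1.3 — STAGE 2, the LEAD's call.
* `stub_offDoorResidual` S4 (honest residual, named; SHRUNK in rev 2): the crux on `¬(p split ∧ E(ℚ_p)[p] = 0)`
  = J1 (`p` NON-SPLIT multiplicative: 34 of the 404 census pairs — 27 at `p = 5`, 7 at `p = 7`, smallest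
  8670u1@5 — each with two split Tamagawa-`p` primes besides `p`; census TSV column `splitp`) ∪ J3
  (`E(ℚ_p)[p] ≠ 0`, defect `m = ord_p #E(ℚ_p)[p^∞] ≥ 1`: MEASURED this revision from the census `j`-invariants —
  47 of the 334 door-type pairs, 36 at `p = 5`, 11 at `p = 7`, all with `m = 1`; so the door proper holds
  287 = 334 − 47 pairs). In `birth.lean` v17 both are covered modulo the published inputs (+ 19064|_{p ≥ 5} on
  S1b); nothing is stranded by keying this file.
* `stub_printedFactsHeld` S0 (CITE): GZK ∧ Kato Thm. 12.5 (4) realisability (tree named facts).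

Composition `EulerHalfNotRamNoInertSetAtFive_of` (kernel-checked, no sorry), three-way: on
`p split ∧ E(ℚ_p)[p] = 0` with `ord_p ∏c_ℓ = ord_p c_p` → S1, S2, S3 and `sha_le_of_door`; with
`ord_p ∏c_ℓ ≠ ord_p c_p` → S1♯, S2, S3 and `sha_le_of_doorTwo`; otherwise S4. In both door branches the
chain is BSD-TIGHT and consistent only because `ord_p #E(ℚ)_tors = 0` (automatic: `ρ̄` onto, `p ≥ 5`) — W1.

KS-IMPRIMITIVITY LEDGER (why the door is cut where it is; rank-0 derivation in `Lines/kato_Fframe.md` §J):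
BSD + Kato's reciprocity law + integral local duality predict that Kato's Kolyvagin system for `(T_pE, F_can)`
at a semistable `p` is divisible by EXACTLY `p^{Σ_{ℓ≠p} ord_p c_ℓ + ord_p #E(ℚ_p)[p^∞]}` (for `p ∤ N` this is
Castella–Sano's (eq:M-kato) `𝓜_∞(κ^{Kato}) = ord_p #E(ℚ_p)[p^∞] + ord_p Tam_E`, a theorem given the IMC;
Kim's Kurihara numbers see the full `ord_p Tam_E` because `δ̃` and `κ^{Kato}` differ by the local index). The
door is the locus where the predicted exponent is `0` (Kato's system PRIMITIVE): there S1's bound is sharp and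
S3 ⟺ «Euler half ∧ primitivity». J2 is the `Σ_{ℓ≠p}` part (S1♯), J3 the `#E(ℚ_p)[p^∞]` part (residual; the
graded chain `sha_le_graded_of_chain` records what S1 + S2′ give there: `sha ≤ sha_an + m`).

Why no posited integer interface (`structure FframeDatum` of bare valuations): every ∀-stub over
non-tree-pinned integers is FALSE on junk data and every ∃-packaging does not compose (g35 NOTES, dead ends
1–4); the genuine waist — admissible class + Kummer log + `log_ω` of the generator — IS tree vocabulary.

Disproof ledger honoured: none of the stubs is an instance of a landed Negative lemma of this crux
(`ledger negatives --problem BirchSwinnertonDyer`: no statement about `HasLocPKummerLog` / admissible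
classes / `MissingUpperBoundAt` at a multiplicative prime is refuted); S4 is strictly weaker than the crux
(extra hypothesis), and no stub implies the crux or the route leaf cheaply (probe table in the card).
-/

noncomputable section

open scoped Classical

set_option linter.dupNamespace false

namespace Summit.BirchSwinnertonDyer.BirchSwinnertonDyer.Cruxes.EulerHalfNotRamNoInertSetAtFive.KatoFframe

open Field
open Literature.NumberTheory.GaloisRepresentations
open Literature.NumberTheory.EllipticCurves Literature.NumberTheory.EllipticCurves.Kato2004
open Literature.NumberTheory.EllipticCurves.Kato2004.EulerSystemValues
open Literature.NumberTheory.EllipticCurves.Rank1Residual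
open Literature.NumberTheory.EllipticCurves.Rank1Residual.Typed
open Summit.BirchSwinnertonDyer.Rank1Residual
open Summit.BirchSwinnertonDyer.BirchSwinnertonDyer.Theses.ErratumRoadFive

/-! ## §0 Vocabulary (definitions with bodies; nothing asserted) -/

/-- `E(ℚ) → E(ℚ_p)` on points (Mathlib's `Point.map` along `ℚ → ℚ_p`; same body as the tree's
`WeierstrassCurve.toPadicPoint`). [folklore] -/
abbrev toLocalPoint (W : WeierstrassCurve ℚ) (p : ℕ) [Fact p.Prime] :
    W.toAffine.Point →+ (W.baseChange ℚ_[p]).toAffine.Point :=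
  WeierstrassCurve.Affine.Point.map (W' := W.toAffine) (S := ℚ) (Algebra.ofId ℚ ℚ_[p])

/-- `log_ω(x) ∈ ℚ_p` of a RATIONAL point `x ∈ E(ℚ)` (Néron differential, `W` globally minimal):
`padicLogLocal` of its image in `E(ℚ_p)`. [cite: SilvermanAEC2009, IV.6.4 and VII.2.2] -/
def logOmega (W : WeierstrassCurve ℚ) [W.IsElliptic] [W.IsGloballyMinimal] (p : ℕ) [Fact p.Prime]
    (x : W.toAffine.Point) : ℚ_[p] :=
  padicLogLocal W p (toLocalPoint W p x)

/-- The BOTTOM LAYER `z_ℚ ∈ H¹(ℚ, T_pE)` of a class `z₀` of a pinned Iwasawa cohomology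
`I : IwasawaH1Data W p K γ` (`I.proj 0`, moved to `⊤` by `layerZeroToTop`).
[cite: Kato2004Asterisque, §12.2 (p. 220) and §14.14 (14.14.1) (p. 243)] -/
def bottomClass (W : WeierstrassCurve ℚ) [W.IsElliptic] (p : ℕ) [Fact p.Prime]
    [ContinuousSMul ℤ_[p] (W.tateModule p)] (K : ZpExtension ℚ p) {γ : absoluteGaloisGroup ℚ}
    (I : IwasawaH1Data W p K γ) (z₀ : I.H) : H1 (tateRep W p) ⊤ :=
  layerZeroToTop W p K (I.proj 0 z₀)

/-! The DOOR REGIME is stated INLINE in the stub signatures (rev 2; pen hygiene item / critic W6: no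
`def … : Prop` in a crux workfile): «`W.HasSplitMultiplicativeReductionAtPrime p`» (p split multiplicative),
«`padicValNat p W.tamagawaProduct = padicValNat p (padicValInt p W.minimalDiscriminantInt)`» (`ord_p ∏c_ℓ =
ord_p c_p`, `c_p = ord_p Δ_min` at a split multiplicative prime), «`∀ Q, p • Q = 0 → Q = 0`» on
`E(ℚ_p)` (`E(ℚ_p)[p] = 0`). -/

/-! ## §1 The registered-shape stubs (2 ≤ k ≤ 7; sorries ONLY here) -/

/-- **S0 (CITE) printed facts held as tree named facts**: Gross–Zagier–Kolyvagin («`r_an ≤ 1 ⇒ rank =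
r_an ∧ Ш finite`») and Kato Thm. 12.5 (4) realisability of an admissible zeta class in every pinned
`𝐇¹_Γ(T_pE)` under (12.5.2). Closed at route level by `(h : Fact)` binders, never by a proof here.
[cite: Kato2004Asterisque, Thm. 12.5 (4) with (12.5.2) (p. 222)] [cite: Darmon2004, Thm. 3.22] -/
theorem stub_printedFactsHeld :
    rank_eq_analyticRank_of_analyticRank_le_one ∧ exists_isAdmissibleZetaClass_of_imageContainsSL2 := by
  sorry

/-- **S1 (PRINT, L) Kato–Kolyvagin bound in logarithm currency at analytic rank one, any reduction at `p`.**
For `p ≥ 5`, `ρ̄_{E,p}` onto, `r_an(E) = 1`, a Mordell–Weil generator `x̂ = P 0`, an admissible Kato class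
`z₀` with bottom Kummer logarithm `t ≠ 0`, and ANY local point `Q ∈ E(ℚ_p)` with `log_ω(Q) ≠ 0`:
`ord_p #Ш + ord_p log_ω(x̂) − ord_p log_ω(Q) ≤ ord_p t − ord_p log_ω(x̂)`.
Print chain: MR Thm. 5.2.2 / Kim 2022 Thm. 2.12 (`length Sel₀(ℚ,E[p^∞]) ≤ ∂⁰(κ^{Kato})`, `κ₁ ∈ ℤ_pˣ·z_ℚ`);
`length Sel₀ = ord_p #Ш + e`, `e = length ker(E(ℚ)⊗ℚ_p/ℤ_p → E(ℚ_p)⊗ℚ_p/ℤ_p) = ord_p log_ω(x̂) − min ord_p log_ω`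
(rank one, `Ш[p^∞]` finite by GZK); `Sel_rel(ℚ,T_pE) = ℤ_p x̂` (Bloch–Kato Ex. 3.11, `E(ℚ)[p] = 0`), so
`∂⁰ = ord_p t − ord_p log_ω(x̂)`. Why it might fail: the identification of the admissible bottom layer with
MR's `κ₁` is up to `ℤ_pˣ` only after Kato's multiplier `M̃` is divided out ((A6′) of `AdmissibleZetaClassBody`)
— a `p`-power slip there shifts `t`. Stage-2 hygiene (critic W3/W4): MR §6.2 / Kim run under `p`-ADIC
surjectivity `ρ_{E,p^∞}(G_ℚ) = GL₂(ℤ_p)`, which is Serre's lemma from `Surj W p` for `p ≥ 5` (one named line);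
`Sel₀` is the `p`-STRICT Selmer group (dual Selmer structure `F_can^*` = strict at `p`), not the fine one; the
XS lemma `logOmega W p x̂ ≠ 0` (non-torsion rational point ⇒ non-torsion in `E(ℚ_p)` ⇒ formal log `≠ 0`) is
used silently through `.valuation` and belongs to the Stage-2 list. [cite: MazurRubin2004, Thm. 5.2.2]
[cite: Kim2022StructureSelmer, Thm. 2.12 and Cor. 2.15] [cite: BlochKato1990, Ex. 3.11] -/
theorem stub_katoKolyvaginLogBound :
    ∀ (W : WeierstrassCurve ℚ) [W.IsElliptic] [W.IsGloballyMinimal] (p : ℕ) [Fact p.Prime]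
      [ContinuousSMul ℤ_[p] (W.tateModule p)],
      5 ≤ p → Surj W p → W.analyticRank = 1 →
      ∀ (h1 : W.mordellWeilRank = 1) (P : Fin W.mordellWeilRank → W.toAffine.Point),
        W.IsMordellWeilBasis P →
      ∀ (K : ZpExtension ℚ p) (hK : K.IsCyclotomic) (γ : absoluteGaloisGroup ℚ)
        (I : IwasawaH1Data W p K γ) (z₀ : I.H), K.IsTopGenerator γ → IsAdmissibleZetaClass W p K hK I z₀ →
      ∀ t : ℚ_[p], HasLocPKummerLog W p (bottomClass W p K I z₀) t → t ≠ 0 →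
      ∀ Q : (W.baseChange ℚ_[p]).toAffine.Point, padicLogLocal W p Q ≠ 0 →
        (padicValNat p W.shaOrder : ℤ) + (logOmega W p (P (Fin.cast h1.symm 0))).valuation
            - (padicLogLocal W p Q).valuation ≤
          t.valuation - (logOmega W p (P (Fin.cast h1.symm 0))).valuation := by
  sorry

/-- **S1♯ (PRINT-OPEN, XL; new in rev 2) Kato–Kolyvagin bound WITH THE AWAY-FROM-`p` TAMAGAWA DEFECT, log
currency, split multiplicative `p`.** Same frame as S1, plus `p` SPLIT multiplicative and a SECOND prime carrying
`p` in the Tamagawa product (`ord_p ∏c_ℓ ≠ ord_p c_p`, `c_p = ord_p Δ_min`): then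
`ord_p #Ш + ord_p log_ω(x̂) − ord_p log_ω(Q) + (ord_p ∏c_ℓ − ord_p c_p) ≤ ord_p t − ord_p log_ω(x̂)`.
Equivalently (given S1's print chain): Kato's Kolyvagin system `κ^{Kato} ∈ KS(T_pE, F_can)` is divisible by
`p^{Σ_{ℓ≠p} ord_p c_ℓ}` («Tamagawa defect»). Status: ONE factor `p^{ord_p c_ℓ}` (any single `ℓ ≠ p` with
`p ∣ c_ℓ`) is Büyükboduk 2009 Thm. B / Cor. «elliptic cokernel» [arXiv:0710.3858 pp. 10–12] (hypotheses `p > 3`,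
`ρ_{E,p^∞}` onto; no reduction hypothesis at `p`); the FULL product is his Question 2 (open) = the Tamagawa part
of Kim's Conj. 1.10 (`𝓜_∞(δ̃) = ord_p Tam_E`); for `p ∤ N` Castella–Sano 2026 (eq:M-kato) prove
`𝓜_∞(κ^{Kato}) = ord_p #E(ℚ_p)[p^∞] + ord_p Tam_E` GIVEN Kato's main conjecture [arXiv:2601.14504 p. 10] — at
`p ∥ N` no such descent is in print. BSD predicts the statement with EQUALITY at the minimising `Q` (card §J).
Serves the J2 pairs (in the crux class: `p` split and two further split multiplicative primes `q₁, q₂` with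
`p ∣ ord_{q_i}Δ`; 36 of the 404 census pairs — 33 at `p = 5`, 2 at `p = 7`, 1 at `p = 11`; smallest 8085y1@5,
12705q1@7, 16905bb1@5; at 35 of them `p ∤ c_p`, so `E(ℚ_p)[p] = 0` is automatic, at 129360cy1@5 `p ∣ c_p` too —
census TSV `bsd-stepL/shim/notram_census_j254667.tsv`), where Thm. B alone leaves the slack
`min(ord_p c_{q₁}, ord_p c_{q₂})`. Why it might fail: it should not (BSD-predicted); what can fail is
provability — the second factor needs the divided classes to stay in `F_can` at the other prime (Büyükboduk's
obstruction, §3). [cite: Buyukboduk2009TamagawaDefect, Thm. B and Question 2] [cite: Kim2022StructureSelmer, Conj. 1.10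
and Thm. 2.12] [cite: CastellaSano2026, §2.4 (eq:M-kato)] -/
theorem stub_katoKolyvaginLogBoundTamagawa :
    ∀ (W : WeierstrassCurve ℚ) [W.IsElliptic] [W.IsGloballyMinimal] (p : ℕ) [Fact p.Prime]
      [ContinuousSMul ℤ_[p] (W.tateModule p)],
      5 ≤ p → Surj W p → W.analyticRank = 1 → W.HasSplitMultiplicativeReductionAtPrime p →
      padicValNat p W.tamagawaProduct ≠ padicValNat p (padicValInt p W.minimalDiscriminantInt) →
      ∀ (h1 : W.mordellWeilRank = 1) (P : Fin W.mordellWeilRank → W.toAffine.Point),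
        W.IsMordellWeilBasis P →
      ∀ (K : ZpExtension ℚ p) (hK : K.IsCyclotomic) (γ : absoluteGaloisGroup ℚ)
        (I : IwasawaH1Data W p K γ) (z₀ : I.H), K.IsTopGenerator γ → IsAdmissibleZetaClass W p K hK I z₀ →
      ∀ t : ℚ_[p], HasLocPKummerLog W p (bottomClass W p K I z₀) t → t ≠ 0 →
      ∀ Q : (W.baseChange ℚ_[p]).toAffine.Point, padicLogLocal W p Q ≠ 0 →
        (padicValNat p W.shaOrder : ℤ) + (logOmega W p (P (Fin.cast h1.symm 0))).valuation
            - (padicLogLocal W p Q).valuation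
            + ((padicValNat p W.tamagawaProduct : ℤ) - padicValNat p (padicValInt p W.minimalDiscriminantInt)) ≤
          t.valuation - (logOmega W p (P (Fin.cast h1.symm 0))).valuation := by
  sorry

/-- **S2 (PROVABLE, M–L) Tate-uniformisation log value.** At a split multiplicative prime `p ≥ 5` with
`E(ℚ_p)[p] = 0` there is a local point `Q ∈ E(ℚ_p)` with `log_ω(Q) ≠ 0` and
`ord_p log_ω(Q) = 1 − ord_p(c_p)`, `c_p = ord_p Δ_min = [E(ℚ_p):E₀(ℚ_p)]` (`E(ℚ_p) ≅ ℚ_pˣ/q^ℤ`,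
`log_ω = log_q ∘ Φ_Tate⁻¹` with `log_q(q) = 0`; witness `Φ_Tate(1+p)` if `p ∤ c_p`, `Φ_Tate(p)` if `p ∣ c_p`,
where `E(ℚ_p)[p] ≠ 0 ⟺ p ∣ c_p ∧ log_p(q/p^{ord q}) ∈ p²ℤ_p` — W2; in general the minimum of `ord_p log_ω` on
`E(ℚ_p)` is `1 − ord_p c_p + ord_p #E(ℚ_p)[p^∞]` (S2′), so the hypothesis `E(ℚ_p)[p] = 0` is exactly what makes the
S2 value the minimum). Why it might fail: only through the normalisation of
`padicLogLocal` (`log(m₀•Q)/m₀`, `m₀ = [E(ℚ_p):E₁(ℚ_p)] = (p−1)·ord_p Δ_min`), re-derived above to give `log_q`.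
Leans on: tree `SteinWuthrich2013/SplitUniformizationData*`, `padicLogPoint`.
[cite: SilvermanATAEC1994, V.3.1, V.4.1 and V.5.3] [cite: SilvermanAEC2009, IV.6.4 (b)] -/
theorem stub_tateUniformisationLogValue :
    ∀ (W : WeierstrassCurve ℚ) [W.IsElliptic] [W.IsGloballyMinimal] (p : ℕ) [Fact p.Prime],
      5 ≤ p → W.HasSplitMultiplicativeReductionAtPrime p →
      (∀ Q : (W.baseChange ℚ_[p]).toAffine.Point, p • Q = 0 → Q = 0) →
      ∃ Q : (W.baseChange ℚ_[p]).toAffine.Point, padicLogLocal W p Q ≠ 0 ∧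
        (padicLogLocal W p Q).valuation = 1 - (padicValNat p (padicValInt p W.minimalDiscriminantInt) : ℤ) := by
  sorry

/-- **S3 (THE TRANSFER C⁺, XL — the door) integral exceptional-zero Perrin-Riou value, valuation form,
upper half.** For `(E,p)` in X11b with `p ≥ 5`, `ρ̄_{E,p}` onto and `p` SPLIT multiplicative, a Mordell–Weil
generator `x̂ = P 0` and an admissible Kato class `z₀`: `#Ш_an` is a rational `q`, the bottom layer of `z₀`
has a NON-ZERO Kummer logarithm `t` (Venerucci Thm. A (2) + Thm. B at `r_an = 1`), and
`ord_p t − 2·ord_p log_ω(x̂) ≤ ord_p q + ord_p ∏ c_ℓ − 2·ord_p #E(ℚ)_tors − 1` (`−1 = ord_p(1 − p⁻¹)`).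
Print: equality up to `ℚˣ` (Venerucci 2016 Thm. A `log_A(res_p ζ^{BK}) = ℓ₁ log_A²(𝐏)` [arXiv:1407.1913 p. 3];
Disegni 2020 Prop. 5). Proposed proof of the integral form = F-frame chain S3–S6 of
`Lines/kato_bottom_layer_Fframe.md` rev 1.3 (Stage 2). Why it might fail: an uncancelled `p`-power in the
unwinding constants (Manin constant of the Shimura-curve parametrisation over `F`, Mok's `ξ(2)`, the
Petersson-measure ratio — audited to `κ = 0` in words only), or `ℓ₁`'s `ord_p(q_E)` entering with the
wrong sign. BOOKKEEPING (critic W1): the term `− 2·ord_p #E(ℚ)_tors` is `0` here (`ρ̄` onto, `p ≥ 5` ⇒ `E(ℚ)[p] = 0`)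
and the door chain S1 ∧ S2 ∧ S3 is BSD-consistent — indeed BSD-TIGHT, equalities throughout — ONLY because of it;
do not «generalise» S3 to `p ∣ #E(ℚ)_tors`. Standing hypotheses of the print support (Venerucci Thm. A):
conductor `Np`, `p > 3` split multiplicative, `A_p` irreducible, `L(A,1) = 0`; no hypothesis on `ord_p(q_A)`.
[cite: Venerucci2016, Thm. A] [cite: Disegni2020, Prop. 5] [cite: Mok2011, Thm. 1.1] [cite: PerrinRiou1993AIF, §3.3] -/
theorem stub_integralExcZeroValue :
    ∀ (W : WeierstrassCurve ℚ) [W.IsElliptic] [W.IsGloballyMinimal] (p : ℕ) [Fact p.Prime]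
      [ContinuousSMul ℤ_[p] (W.tateModule p)],
      ClassX11b W p → 5 ≤ p → Surj W p → W.HasSplitMultiplicativeReductionAtPrime p →
      ∀ (h1 : W.mordellWeilRank = 1) (P : Fin W.mordellWeilRank → W.toAffine.Point),
        W.IsMordellWeilBasis P →
      ∀ (K : ZpExtension ℚ p) (hK : K.IsCyclotomic) (γ : absoluteGaloisGroup ℚ)
        (I : IwasawaH1Data W p K γ) (z₀ : I.H), K.IsTopGenerator γ → IsAdmissibleZetaClass W p K hK I z₀ →
      ∃ (q : ℚ) (t : ℚ_[p]), shaAn W = (q : ℂ) ∧ HasLocPKummerLog W p (bottomClass W p K I z₀) t ∧ t ≠ 0 ∧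
        t.valuation - 2 * (logOmega W p (P (Fin.cast h1.symm 0))).valuation ≤
          padicValRat p q + padicValNat p W.tamagawaProduct - 2 * padicValNat p W.torsionOrder - 1 := by
  sorry

/-- **S4 (RESIDUAL, honest and named; shrunk in rev 2) the crux OFF `p split ∧ E(ℚ_p)[p] = 0`.** The crux
hypotheses together with `¬ (p split multiplicative ∧ E(ℚ_p)[p] = 0)`, i.e. (D-0171 tags, critic W5):
J1 — `p` NON-SPLIT multiplicative: no exceptional zero, `c_p ∈ {1,2}` so the Tamagawa-`p` prime is some `ℓ ≠ p`
(EulerSystemTamagawaDefect bites as catalogued; input type = S1♯ at `ℓ` + a rank-one Perrin-Riou value at a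
non-split prime; no print found by this seat); 34 of the 404 census pairs (27 at `p = 5`, 7 at `p = 7`; smallest
8670u1@5, 14560d1@5, 15390r1@5, 17955m1@7), each with two split Tamagawa-`p` primes besides the non-split `p`
(census TSV `bsd-stepL/shim/notram_census_j254667.tsv`, column `splitp`). J3 — `p` split with `E(ℚ_p)[p] ≠ 0`
(⟺ `p ∣ c_p ∧ u_q ∈ (ℤ_pˣ)^p`): ATTACKABLE by the same chain with the defect at `p` booked — S1 + S2′
(`min ord_p log_ω = 1 − ord_p c_p + m`, `m = ord_p #E(ℚ_p)[p^∞] ≥ 1`) + S3 give `ord_p #Ш ≤ ord_p #Ш_an + m`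
(`sha_le_graded_of_chain`), sharp iff Kato's Kolyvagin system is divisible by `p^m = #E(ℚ_p)[p^∞]` (the
«Tamagawa factor at `p`» of Castella–Sano's (eq:M-kato), in print only for `p ∤ N` and only given the IMC);
size MEASURED (g36, local 1-s script `j3count.py` on the census `j`-invariants: `u_q ≡` unit part of `1/j mod p^{c_p}`,
`c_p ≥ 5`; J3 ⟺ `p ∣ c_p ∧ u_q^{p−1} ≡ 1 mod p²`): 47 of the 334 door-type pairs (36 at `p = 5`, 11 at `p = 7`,
0 at 11, 13), ALL with `m = 1` (so the J3 chain is exactly one `p` short); smallest 5600t1@7, 6615d1@5, 6615i1@5,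
11200ck1@7; the door proper = 287 pairs (229@5, 53@7, 4@11, 1@13). J2 (second Tamagawa-`p` prime, `p` split, `E(ℚ_p)[p] = 0`) LEFT the residual in rev 2: it
is served by S1♯ ∧ S2 ∧ S3. Coverage by the line of record: `birth.lean` v17 closes the WHOLE class modulo the
published inputs {19066, 19524, 19716, 20442, 23091} + crux 19064 at `p ≥ 5`, so keying this file strands
nothing. Strictly weaker than the crux; no line of this file reaches it. Why it might fail: it is the crux on a
sub-class. [cite: Kato2004Asterisque, Thm. 17.4] [cite: Kim2022StructureSelmer, Thm. 2.12] -/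
theorem stub_offDoorResidual :
    ∀ (W : WeierstrassCurve ℚ) [W.IsElliptic] [W.IsGloballyMinimal] (p : ℕ) [Fact p.Prime],
      ClassX11b W p → 5 ≤ p → Surj W p → ¬ Ram W p → p ∣ W.tamagawaProduct →
      ¬ (∃ S : Finset ℕ, (∀ ℓ ∈ S, ∃ _ : Fact ℓ.Prime, Mult W ℓ) ∧ Even S.card ∧ p ∈ S ∧
          (∀ (ℓ : ℕ) [Fact ℓ.Prime], ℓ ∉ S → W.HasSplitMultiplicativeReductionAtPrime ℓ →
            ¬ p ∣ padicValInt ℓ W.minimalDiscriminantInt) ∧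
          (¬ p ∣ padicValInt p W.minimalDiscriminantInt ∨
            ∃ R ⊆ S, S.card = 2 * R.card ∧ ∀ q ∈ R, q ≠ 2 ∧ ¬ p ∣ q - 1)) →
      ¬ (W.HasSplitMultiplicativeReductionAtPrime p ∧
          ∀ Q : (W.baseChange ℚ_[p]).toAffine.Point, p • Q = 0 → Q = 0) →
      MissingUpperBoundAt W p := by
  sorry

/-! ## §2 The composition (kernel-checked; concludes the crux BY NAME) -/

/-- The GRADED bottom-layer chain at a split multiplicative prime, as pure arithmetic over `ℤ` (all number
theory in the hypotheses; the common parent of both door branches and the record of what the chain gives on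
J3): a Kolyvagin bound `hB` carrying a booked defect `d` on the left, the general local minimum
`hQ : vQ = 1 − c + m` (`m = ord_p #E(ℚ_p)[p^∞]`, S2′; `m = 0` under `E(ℚ_p)[p] = 0`) and the C⁺ value `hC` (S3)
give `sha ≤ vq + (ctot − c − d) + m − 2·vtors` — the Euler half exactly when the booked defect `d` reaches
`(ctot − c) + m = Σ_{ℓ≠p} ord_p c_ℓ + ord_p #E(ℚ_p)[p^∞]`, BSD's predicted divisibility exponent of Kato's
Kolyvagin system (KS-imprimitivity ledger of the header). -/
theorem sha_le_graded_of_chain (sha vx vQ vt vq ctot c m d vtors : ℤ)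
    (hB : sha + vx - vQ + d ≤ vt - vx) (hQ : vQ = 1 - c + m)
    (hC : vt - 2 * vx ≤ vq + ctot - 2 * vtors - 1) :
    sha ≤ vq + (ctot - c - d) + m - 2 * vtors := by
  omega

/-- The door branch (`d = 0`, `m = 0`): `hB` = S1 at the S2-witness, `hQ` = S2, `hC` = S3,
`hcc` = `ord_p ∏c_ℓ = ord_p c_p`. -/
theorem sha_le_of_door (sha vx vQ vt vq ctot c vtors : ℤ)
    (hB : sha + vx - vQ ≤ vt - vx) (hQ : vQ = 1 - c)
    (hC : vt - 2 * vx ≤ vq + ctot - 2 * vtors - 1) (hcc : ctot = c) (htors : 0 ≤ vtors) :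
    sha ≤ vq := by
  have h := sha_le_graded_of_chain sha vx vQ vt vq ctot c 0 0 vtors
    (by rw [add_zero]; exact hB) (by rw [add_zero]; exact hQ) hC
  omega

/-- The J2 branch (rev 2; `d = ctot − c`, `m = 0`): `hB` = S1♯ at the S2-witness, `hQ` = S2, `hC` = S3; the
defect cancels against S3's `+ ctot` and S2's `− c` with NO sign condition on `ctot − c`. -/
theorem sha_le_of_doorTwo (sha vx vQ vt vq ctot c vtors : ℤ)
    (hB : sha + vx - vQ + (ctot - c) ≤ vt - vx) (hQ : vQ = 1 - c)
    (hC : vt - 2 * vx ≤ vq + ctot - 2 * vtors - 1) (htors : 0 ≤ vtors) :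
    sha ≤ vq := by
  have h := sha_le_graded_of_chain sha vx vQ vt vq ctot c 0 (ctot - c) vtors hB
    (by rw [add_zero]; exact hQ) hC
  omega

/-- **`EulerHalfNotRamNoInertSetAtFive` from the six stubs.** On `p split ∧ E(ℚ_p)[p] = 0`: GZK gives rank
one and a Mordell–Weil generator (tree theorem `exists_isMordellWeilBasis_holds`), Kato 12.5 (4) an admissible
class (tree corollary `exists_datum_of_hasSurjectiveModNGaloisRep`), S3 the value, S2 the local witness, then
S1 (`ord_p ∏c_ℓ = ord_p c_p`, `sha_le_of_door`) or S1♯ (`≠`, `sha_le_of_doorTwo`); otherwise S4. -/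
theorem EulerHalfNotRamNoInertSetAtFive_of
    (hF : rank_eq_analyticRank_of_analyticRank_le_one ∧ exists_isAdmissibleZetaClass_of_imageContainsSL2)
    (hS1 : ∀ (W : WeierstrassCurve ℚ) [W.IsElliptic] [W.IsGloballyMinimal] (p : ℕ) [Fact p.Prime]
      [ContinuousSMul ℤ_[p] (W.tateModule p)],
      5 ≤ p → Surj W p → W.analyticRank = 1 →
      ∀ (h1 : W.mordellWeilRank = 1) (P : Fin W.mordellWeilRank → W.toAffine.Point),
        W.IsMordellWeilBasis P →
      ∀ (K : ZpExtension ℚ p) (hK : K.IsCyclotomic) (γ : absoluteGaloisGroup ℚ)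
        (I : IwasawaH1Data W p K γ) (z₀ : I.H), K.IsTopGenerator γ → IsAdmissibleZetaClass W p K hK I z₀ →
      ∀ t : ℚ_[p], HasLocPKummerLog W p (bottomClass W p K I z₀) t → t ≠ 0 →
      ∀ Q : (W.baseChange ℚ_[p]).toAffine.Point, padicLogLocal W p Q ≠ 0 →
        (padicValNat p W.shaOrder : ℤ) + (logOmega W p (P (Fin.cast h1.symm 0))).valuation
            - (padicLogLocal W p Q).valuation ≤
          t.valuation - (logOmega W p (P (Fin.cast h1.symm 0))).valuation)
    (hS1' : ∀ (W : WeierstrassCurve ℚ) [W.IsElliptic] [W.IsGloballyMinimal] (p : ℕ) [Fact p.Prime]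
      [ContinuousSMul ℤ_[p] (W.tateModule p)],
      5 ≤ p → Surj W p → W.analyticRank = 1 → W.HasSplitMultiplicativeReductionAtPrime p →
      padicValNat p W.tamagawaProduct ≠ padicValNat p (padicValInt p W.minimalDiscriminantInt) →
      ∀ (h1 : W.mordellWeilRank = 1) (P : Fin W.mordellWeilRank → W.toAffine.Point),
        W.IsMordellWeilBasis P →
      ∀ (K : ZpExtension ℚ p) (hK : K.IsCyclotomic) (γ : absoluteGaloisGroup ℚ)
        (I : IwasawaH1Data W p K γ) (z₀ : I.H), K.IsTopGenerator γ → IsAdmissibleZetaClass W p K hK I z₀ →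
      ∀ t : ℚ_[p], HasLocPKummerLog W p (bottomClass W p K I z₀) t → t ≠ 0 →
      ∀ Q : (W.baseChange ℚ_[p]).toAffine.Point, padicLogLocal W p Q ≠ 0 →
        (padicValNat p W.shaOrder : ℤ) + (logOmega W p (P (Fin.cast h1.symm 0))).valuation
            - (padicLogLocal W p Q).valuation
            + ((padicValNat p W.tamagawaProduct : ℤ) - padicValNat p (padicValInt p W.minimalDiscriminantInt)) ≤
          t.valuation - (logOmega W p (P (Fin.cast h1.symm 0))).valuation)
    (hS2 : ∀ (W : WeierstrassCurve ℚ) [W.IsElliptic] [W.IsGloballyMinimal] (p : ℕ) [Fact p.Prime],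
      5 ≤ p → W.HasSplitMultiplicativeReductionAtPrime p →
      (∀ Q : (W.baseChange ℚ_[p]).toAffine.Point, p • Q = 0 → Q = 0) →
      ∃ Q : (W.baseChange ℚ_[p]).toAffine.Point, padicLogLocal W p Q ≠ 0 ∧
        (padicLogLocal W p Q).valuation = 1 - (padicValNat p (padicValInt p W.minimalDiscriminantInt) : ℤ))
    (hS3 : ∀ (W : WeierstrassCurve ℚ) [W.IsElliptic] [W.IsGloballyMinimal] (p : ℕ) [Fact p.Prime]
      [ContinuousSMul ℤ_[p] (W.tateModule p)],
      ClassX11b W p → 5 ≤ p → Surj W p → W.HasSplitMultiplicativeReductionAtPrime p →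
      ∀ (h1 : W.mordellWeilRank = 1) (P : Fin W.mordellWeilRank → W.toAffine.Point),
        W.IsMordellWeilBasis P →
      ∀ (K : ZpExtension ℚ p) (hK : K.IsCyclotomic) (γ : absoluteGaloisGroup ℚ)
        (I : IwasawaH1Data W p K γ) (z₀ : I.H), K.IsTopGenerator γ → IsAdmissibleZetaClass W p K hK I z₀ →
      ∃ (q : ℚ) (t : ℚ_[p]), shaAn W = (q : ℂ) ∧ HasLocPKummerLog W p (bottomClass W p K I z₀) t ∧ t ≠ 0 ∧
        t.valuation - 2 * (logOmega W p (P (Fin.cast h1.symm 0))).valuation ≤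
          padicValRat p q + padicValNat p W.tamagawaProduct - 2 * padicValNat p W.torsionOrder - 1)
    (hS4 : ∀ (W : WeierstrassCurve ℚ) [W.IsElliptic] [W.IsGloballyMinimal] (p : ℕ) [Fact p.Prime],
      ClassX11b W p → 5 ≤ p → Surj W p → ¬ Ram W p → p ∣ W.tamagawaProduct →
      ¬ (∃ S : Finset ℕ, (∀ ℓ ∈ S, ∃ _ : Fact ℓ.Prime, Mult W ℓ) ∧ Even S.card ∧ p ∈ S ∧
          (∀ (ℓ : ℕ) [Fact ℓ.Prime], ℓ ∉ S → W.HasSplitMultiplicativeReductionAtPrime ℓ →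
            ¬ p ∣ padicValInt ℓ W.minimalDiscriminantInt) ∧
          (¬ p ∣ padicValInt p W.minimalDiscriminantInt ∨
            ∃ R ⊆ S, S.card = 2 * R.card ∧ ∀ q ∈ R, q ≠ 2 ∧ ¬ p ∣ q - 1)) →
      ¬ (W.HasSplitMultiplicativeReductionAtPrime p ∧
          ∀ Q : (W.baseChange ℚ_[p]).toAffine.Point, p • Q = 0 → Q = 0) →
      MissingUpperBoundAt W p) :
    EulerHalfNotRamNoInertSetAtFive := by
  intro W _ _ p _ hX h5 hSurj hnRam hTam hNoS
  by_cases hD : W.HasSplitMultiplicativeReductionAtPrime p ∧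
      ∀ Q : (W.baseChange ℚ_[p]).toAffine.Point, p • Q = 0 → Q = 0
  · obtain ⟨hsplit, hnoptor⟩ := hD
    haveI : ContinuousSMul ℤ_[p] (W.tateModule p) := TateModule.continuousSMul_padicInt
    have hr1 : W.analyticRank = 1 := hX.1
    have hmw : W.mordellWeilRank = 1 := by
      have h := (hF.1 W (le_of_eq hr1)).1
      omega
    obtain ⟨P, hP⟩ := W.exists_isMordellWeilBasis_holds
    obtain ⟨K, hK, γ, I, z₀, hγ, hz⟩ := hF.2.exists_datum_of_hasSurjectiveModNGaloisRep W p h5 hSurj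
    obtain ⟨q, t, hq, ht, ht0, hC⟩ := hS3 W p hX h5 hSurj hsplit hmw P hP K hK γ I z₀ hγ hz
    obtain ⟨Q, hQ0, hQv⟩ := hS2 W p h5 hsplit hnoptor
    refine ⟨q, hq, ?_⟩
    by_cases hcc : padicValNat p W.tamagawaProduct = padicValNat p (padicValInt p W.minimalDiscriminantInt)
    · have hB := hS1 W p h5 hSurj hr1 hmw P hP K hK γ I z₀ hγ hz t ht ht0 Q hQ0
      have hcc' : (padicValNat p W.tamagawaProduct : ℤ) =
          (padicValNat p (padicValInt p W.minimalDiscriminantInt) : ℤ) := by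
        exact_mod_cast hcc
      exact sha_le_of_door _ _ _ _ _ _ _ _ hB hQv hC hcc' (by positivity)
    · have hB := hS1' W p h5 hSurj hr1 hsplit hcc hmw P hP K hK γ I z₀ hγ hz t ht ht0 Q hQ0
      exact sha_le_of_doorTwo _ _ _ _ _ _ _ _ hB hQv hC (by positivity)
  · exact hS4 W p hX h5 hSurj hnRam hTam hNoS hD

/-- The same composition keyed by the stub NAMES (so that a skeleton registration — by the LEAD / pen only,
W-79 — would record exactly these six signatures). -/
theorem EulerHalfNotRamNoInertSetAtFive_of_stubs : EulerHalfNotRamNoInertSetAtFive :=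
  EulerHalfNotRamNoInertSetAtFive_of stub_printedFactsHeld stub_katoKolyvaginLogBound
    stub_katoKolyvaginLogBoundTamagawa stub_tateUniformisationLogValue stub_integralExcZeroValue
    stub_offDoorResidual

end Summit.BirchSwinnertonDyer.BirchSwinnertonDyer.Cruxes.EulerHalfNotRamNoInertSetAtFive.KatoFframe

end
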